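import Summits.QuantumFields.BalabanUV.Beta.GAN24.SubAveragingCore

/-!
# `BalabanUV.Beta.GAN24.SubAveragingCoreEstimate` — binder row G-an2-4 ∕ (CONV-C), programme «SUBAVG-RATE»
# (ROUTES-GAN24 R2-S1∕S2 ∘ R3-S3 executed at `U = 1` in the fibre∕strip currency), FILE 2b:
# THE CORE ALIAS ESTIMATE — the once-sub-averaged finer free propagator minus the coarser one is `O(n⁻²)`,
# UNIFORMLY over the non-zero aliases AND over the complex fat region (R2's (P-R2a) in its alias-summed form)

NOT IN PRINT; OUR PROOF ATTEMPT (prover part P3 of row G-an2-4, fibre∕strip lineage, gen 22; CRUX TEAM (2), ruling «YM REDIRECT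
TOWARDS THE SUMMIT», 2026-08-21).  HONEST DEPENDENCY (cell records, verbatim): «continuum YM on T⁴ ⇐ BetaPertH ∧ nine spine
estimates (0/9 proved); BetaPertH ⇐ (D1) ∧ (D4) ∧ CAP+tail; G-an2-4 gates asym, D1 and NE2/3/4.»  HONEST FRAMING (cell contract,
verbatim): «discharging `BetaPertH` makes Bałaban's UV stability UNCONDITIONAL — a real constructive-QFT result; it is NOT the
continuum limit and NOT the Clay problem.»  ABSOLUTE RULE: nothing printed is a hypothesis; [folklore] estimates over the symbols
of `Literature.….B4Strip` ∕ `B4StripCauchy` ∕ `B4StripSums` (vendored there with citation tags) and the siblings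
`SubAveragingDirichlet` ∕ `SubAveragingCore`.  No `def … : Prop`, no sorry.

## The statement (one coarse alias `k ≠ 0`, all its `L^d` sub-aliases `K = Kof k m = k + n·m`)

The once-sub-averaged finer free propagator read at the coarse alias `k` is
`T_k(p) = Σ_{m ∈ (Fin L)^d} W1(Kof k m)(p) ∕ (Δ^{ξ∕L}+m²)(p + 2π·Kof k m)` with the sub-block weight `W1 = Π_ν sw`
(`SubAveragingDirichlet.sw`, entire; `= [Q^{(1)}(−Δ^{ξ∕L}+m²)⁻¹Q^{(1)*}]^(p+2πk)`).  **`norm_T_sub_inv_le`**: for every `k ≠ 0` and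
every `p` in the fat region `Fat d r` (`r ≤ 1∕4`, `d r² ≤ 1∕16` — the region of `B4StripCauchy`, containing every strip `Strip d κ`,
`κ ≤ r`): `‖T_k(p) − 1∕(Δ^ξ+m²)(p+2πk)‖ ≤ CT(d,L,m²) ∕ n²` — NO alias weight is needed on the right (the column carries `u(p+2πk)`),
NO realness of `p` is needed (this is what gives the rate WITH exponential decay downstream); `CT` explicit and crude.

## Mechanism (King's «replace each factor and bound the error», [King1986] p. 672, one level INSIDE the block; ours, complex region)

At the principal sub-alias `M⋆(k)` (FILE 2a) both symbols and the sub-weight are functions of the CENTRED momenta `zc_ν` with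
`‖zc_ν‖ ≤ 11·ω_n(k_ν)`, and the alias weights pair EXACTLY (`W_{nL}(K⋆) = W_n(k)`); FILE 1 gives `Δ^ξ − Δ^{ξ∕L} = O(Σ‖zc_ν‖⁴∕n²)`
(`norm_A_sub_A'_le`, `2·11⁴ = 29282`) and `W1(K⋆) − 1 = O(Σ‖zc_ν‖²∕n²)` (`norm_W1_mstar_sub_one_le`), against the tree's lower bound
`(7∕64)·W ≤ Re Δ(shift)` (`B4StripSums.re_DeltaXi_shift_ge_W`) at BOTH levels — the `ω⁴∕W²` bookkeeping closes with NO loss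
(`Ω = Σ_ν ω_ν² ≤ (d+1)W`); every other sub-alias has `W_{nL}(Kof k m) ≥ n²∕4` (`W_Kof_far`) and contributes `O(n⁻²)` (`norm_far_sum_le`).

## What is proved (FILE 2b)
`W1`, `norm_W1_le` (`≤ 4^d`), `T`, `Om` (`Ω`) with `Om_le`∕`Om_le'`∕`sum_omega_pow_four_le`, the centred representations
`DeltaXi_shift_eq_zc` ∕ `DeltaXi_mul_shift_mstar_eq_zc` ∕ `W1_mstar_eq`, the three inputs `norm_A_sub_A'_le`, `norm_A_le`,
`norm_W1_mstar_sub_one_le`, the constants `CP`, `CT` (`CT_nonneg`), `norm_A'_ge`, `norm_T_le`, `norm_far_sum_le`,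
`norm_principal_sub_inv_le`, and the CORE **`norm_T_sub_inv_le`**.

NOT HERE: the `k = 0` column, `E(nL) − E(n)`, the column assembly (`SubAveragingFibre`); kernels (`SubAveragingKernel`).  0∕4 row-D1
binders touched; NEVER «G-an2-4 closed»; NOT D1, NOT BetaPertH, NOT continuum, NOT Clay.  Provenance: prover-b2b-balaban-gan24-p3-g22-0
(unit `b2b-balaban-gan24-p3`, gen 22), 2026-08-21.
-/

noncomputable section

namespace Summit.QuantumFields.BalabanUV.Beta.GAN24.SubAveragingCoreEstimate

open Complex Finset
open Literature.MathematicalPhysics.QuantumFieldTheory.Balaban1983to89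
open Literature.MathematicalPhysics.QuantumFieldTheory.Balaban1983to89.B4Strip
open Literature.MathematicalPhysics.QuantumFieldTheory.Balaban1983to89.B4StripCauchy
open Literature.MathematicalPhysics.QuantumFieldTheory.Balaban1983to89.B4StripSums
open Summit.QuantumFields.BalabanUV.Beta.GAN24.SubAveragingDirichlet
open Summit.QuantumFields.BalabanUV.Beta.GAN24.SubAveragingCore
open scoped Real

variable {d : ℕ}

/-! ## §1 The sub-block weight `W1`, the once-sub-averaged propagator `T`, the bookkeeping sum `Ω` -/

/-- [folklore] THE SUB-BLOCK WEIGHT of a finer alias `K ∈ (Fin (n·L))^d`: `W1 = Π_ν sw n L K_ν p_ν` — the continued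
`|u^{(1)}(p + 2πK)|²` of the `L`-sub-block averaging (entire). -/
def W1 (n L : ℕ) (K : Fin d → Fin (n * L)) (p : Fin d → ℂ) : ℂ := ∏ ν, sw n L (K ν : ℕ) (p ν)

/-- [folklore] `‖W1‖ ≤ 4^d` wherever `|Im p_ν| ≤ 1`. -/
theorem norm_W1_le (n L : ℕ) (hn : 1 ≤ n) (hL : 1 ≤ L) (K : Fin d → Fin (n * L)) {p : Fin d → ℂ}
    (hp : ∀ ν, |(p ν).im| ≤ 1) : ‖W1 n L K p‖ ≤ 4 ^ d := by
  unfold W1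
  rw [norm_prod]
  calc ∏ ν, ‖sw n L (K ν : ℕ) (p ν)‖ ≤ ∏ _ν : Fin d, (4 : ℝ) :=
        Finset.prod_le_prod (fun _ _ => norm_nonneg _) fun ν _ => norm_sw_le n L hn hL _ _ (hp ν)
    _ = 4 ^ d := by simp

/-- [folklore] THE ONCE-SUB-AVERAGED FINER FREE PROPAGATOR read at the coarse alias `k`:
`T_k(p) = Σ_{m ∈ (Fin L)^d} W1(Kof k m)(p) ∕ (Δ^{ξ∕L}+m²)(p + 2π·Kof k m)` (`= [Q^{(1)}(−Δ^{ξ∕L}+m²)⁻¹Q^{(1)*}]^(p+2πk)`). -/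
def T (n L : ℕ) [NeZero n] [NeZero L] (m2 : ℝ) (k : Fin d → Fin n) (p : Fin d → ℂ) : ℂ :=
  ∑ m : Fin d → Fin L, W1 n L (Kof n L k m) p / DeltaXi (n * L) m2 (shift (n * L) (Kof n L k m) p)

/-- [folklore] the sum of squared alias weights over ALL coordinates, `Ω_n(k) = Σ_ν ω_n(k_ν)²` (`W_n(k) ≤ Ω ≤ W_n(k) + d`). -/
def Om (n : ℕ) (k : Fin d → Fin n) : ℝ := ∑ ν, omega n (k ν : ℕ) ^ 2

/-- [folklore] `Ω ≤ W + d` (the coordinates with `k_ν = 0` contribute `ω_n(0)² = 1` each). -/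
theorem Om_le (n : ℕ) [NeZero n] (k : Fin d → Fin n) : Om n k ≤ W n k + d := by
  have hn : 1 ≤ n := Nat.pos_of_ne_zero (NeZero.ne n)
  unfold Om W
  have h : ∀ ν ∈ (Finset.univ : Finset (Fin d)),
      omega n (k ν : ℕ) ^ 2 ≤ (if (k ν : ℕ) = 0 then 0 else omega n (k ν : ℕ) ^ 2) + 1 := by
    intro ν _
    split_ifs with h0
    · rw [h0, omega_zero n hn]; norm_num
    · linarith
  calc ∑ ν, omega n (k ν : ℕ) ^ 2 ≤ ∑ ν, ((if (k ν : ℕ) = 0 then 0 else omega n (k ν : ℕ) ^ 2) + 1) := Finset.sum_le_sum h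
    _ = (∑ ν, if (k ν : ℕ) = 0 then 0 else omega n (k ν : ℕ) ^ 2) + d := by
        rw [Finset.sum_add_distrib]; simp

/-- [folklore] `Ω ≤ (d+1)·W` for `k ≠ 0` (since `W ≥ 1`). -/
theorem Om_le' (n : ℕ) [NeZero n] (k : Fin d → Fin n) (hk : k ≠ fun _ => 0) : Om n k ≤ ((d : ℝ) + 1) * W n k := by
  have h1 := Om_le n k
  have h2 := one_le_W n k hk
  have hd : (0 : ℝ) ≤ d := Nat.cast_nonneg d
  nlinarith

/-- [folklore] `Σ_ν ω_ν⁴ ≤ Ω²`. -/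
theorem sum_omega_pow_four_le (n : ℕ) (k : Fin d → Fin n) : ∑ ν, omega n (k ν : ℕ) ^ 4 ≤ Om n k ^ 2 := by
  unfold Om
  have h : ∀ ν ∈ (Finset.univ : Finset (Fin d)), omega n (k ν : ℕ) ^ 4 ≤ omega n (k ν : ℕ) ^ 2 * ∑ μ, omega n (k μ : ℕ) ^ 2 := by
    intro ν _
    have : omega n (k ν : ℕ) ^ 2 ≤ ∑ μ, omega n (k μ : ℕ) ^ 2 :=
      Finset.single_le_sum (fun μ _ => sq_nonneg (omega n (k μ : ℕ))) (Finset.mem_univ ν)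
    nlinarith [sq_nonneg (omega n (k ν : ℕ))]
  calc ∑ ν, omega n (k ν : ℕ) ^ 4 ≤ ∑ ν, omega n (k ν : ℕ) ^ 2 * ∑ μ, omega n (k μ : ℕ) ^ 2 := Finset.sum_le_sum h
    _ = (∑ ν, omega n (k ν : ℕ) ^ 2) ^ 2 := by rw [← Finset.sum_mul]; ring

/-- [folklore] the coarse alias symbol through the centred momenta: `(Δ^ξ+m²)(p+2πk) = Σ_ν S_ξ(zc_ν) + m²`. -/
theorem DeltaXi_shift_eq_zc (n : ℕ) [NeZero n] (m2 : ℝ) (k : Fin d → Fin n) (p : Fin d → ℂ) :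
    DeltaXi n m2 (shift n k p) = (∑ ν, Sxi n (zc n (k ν) (p ν))) + m2 := by
  unfold DeltaXi shift
  congr 1
  exact Finset.sum_congr rfl fun ν _ => Sxi_shift_eq_zc n (k ν) (p ν)

/-- [folklore] the PRINCIPAL finer alias symbol through the centred momenta: `(Δ^{ξ∕L}+m²)(p+2πK⋆) = Σ_ν S_{ξ∕L}(zc_ν) + m²`. -/
theorem DeltaXi_mul_shift_mstar_eq_zc (n L : ℕ) [NeZero n] [NeZero L] (m2 : ℝ) (k : Fin d → Fin n) (p : Fin d → ℂ) :
    DeltaXi (n * L) m2 (shift (n * L) (Kof n L k (Mstar n L k)) p) = (∑ ν, Sxi (n * L) (zc n (k ν) (p ν))) + m2 := by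
  unfold DeltaXi shift
  congr 1
  refine Finset.sum_congr rfl fun ν _ => ?_
  rw [Kof_val]
  exact Sxi_mul_Kof_mstar_eq_zc n L (k ν) (p ν)

/-- [folklore] the PRINCIPAL sub-weight through the centred momenta: `W1(K⋆) = Π_ν swc(zc_ν)`. -/
theorem W1_mstar_eq (n L : ℕ) [NeZero n] [NeZero L] (k : Fin d → Fin n) (p : Fin d → ℂ) :
    W1 n L (Kof n L k (Mstar n L k)) p = ∏ ν, swc n L (zc n (k ν) (p ν)) := by
  unfold W1
  refine Finset.prod_congr rfl fun ν _ => ?_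
  rw [Kof_val]
  exact sw_Kof_mstar_eq n L (k ν) (p ν)

/-- [folklore] `‖(Δ^ξ+m²)(p+2πk) − (Δ^{ξ∕L}+m²)(p+2πK⋆)‖ ≤ 29282·Ω²∕n²` on the fat region (FILE 1's two-spacing comparison,
coordinate by coordinate, with `‖zc_ν‖ ≤ 11ω_ν`; `2·11⁴ = 29282`). -/
theorem norm_A_sub_A'_le (n L : ℕ) [NeZero n] [NeZero L] (m2 : ℝ) {r : ℝ} (hr : r ≤ 1 / 4) {p : Fin d → ℂ}
    (hp : p ∈ Fat d r) (k : Fin d → Fin n) :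
    ‖DeltaXi n m2 (shift n k p) - DeltaXi (n * L) m2 (shift (n * L) (Kof n L k (Mstar n L k)) p)‖
      ≤ 29282 * Om n k ^ 2 / (n : ℝ) ^ 2 := by
  have hn : 1 ≤ n := Nat.pos_of_ne_zero (NeZero.ne n)
  have hL : 1 ≤ L := Nat.pos_of_ne_zero (NeZero.ne L)
  have hn0 : (0 : ℝ) < n := by exact_mod_cast hn
  rw [DeltaXi_shift_eq_zc, DeltaXi_mul_shift_mstar_eq_zc, add_sub_add_right_eq_sub, ← Finset.sum_sub_distrib]
  refine (norm_sum_le _ _).trans ?_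
  have h : ∀ ν ∈ (Finset.univ : Finset (Fin d)),
      ‖Sxi n (zc n (k ν) (p ν)) - Sxi (n * L) (zc n (k ν) (p ν))‖ ≤ 29282 * omega n (k ν : ℕ) ^ 4 / (n : ℝ) ^ 2 := by
    intro ν _
    obtain ⟨hre, him, him1⟩ := fat_coord hr hp ν
    have hz := norm_zc_le n (k ν) (p ν) hre him
    have h1 := norm_Sxi_sub_Sxi_mul_le n L hn hL (zc n (k ν) (p ν)) (by rw [zc_im]; exact him1)
    have h2 : ‖zc n (k ν) (p ν)‖ ^ 4 ≤ (11 * omega n (k ν : ℕ)) ^ 4 := pow_le_pow_left₀ (norm_nonneg _) hz 4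
    calc ‖Sxi n (zc n (k ν) (p ν)) - Sxi (n * L) (zc n (k ν) (p ν))‖ ≤ 2 * ‖zc n (k ν) (p ν)‖ ^ 4 / (n : ℝ) ^ 2 := h1
      _ ≤ 2 * (11 * omega n (k ν : ℕ)) ^ 4 / (n : ℝ) ^ 2 := by gcongr
      _ = 29282 * omega n (k ν : ℕ) ^ 4 / (n : ℝ) ^ 2 := by ring
  refine (Finset.sum_le_sum h).trans ?_
  rw [← Finset.sum_div, ← Finset.mul_sum]
  gcongr
  exact sum_omega_pow_four_le n k

/-- [folklore] `‖(Δ^ξ+m²)(p+2πk)‖ ≤ 242·Ω + m²` on the fat region (`‖S_ξ(zc)‖ ≤ 2‖zc‖²`, `2·11² = 242`). -/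
theorem norm_A_le (n : ℕ) [NeZero n] (m2 : ℝ) (hm : 0 ≤ m2) {r : ℝ} (hr : r ≤ 1 / 4) {p : Fin d → ℂ}
    (hp : p ∈ Fat d r) (k : Fin d → Fin n) : ‖DeltaXi n m2 (shift n k p)‖ ≤ 242 * Om n k + m2 := by
  have hn : 1 ≤ n := Nat.pos_of_ne_zero (NeZero.ne n)
  rw [DeltaXi_shift_eq_zc]
  refine (norm_add_le _ _).trans ?_
  rw [Complex.norm_real, Real.norm_eq_abs, abs_of_nonneg hm]
  gcongr
  refine (norm_sum_le _ _).trans ?_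
  unfold Om
  rw [Finset.mul_sum]
  refine Finset.sum_le_sum fun ν _ => ?_
  obtain ⟨hre, him, him1⟩ := fat_coord hr hp ν
  have hz := norm_zc_le n (k ν) (p ν) hre him
  have h1 := norm_Sxi_le n hn (zc n (k ν) (p ν)) (by rw [zc_im]; exact him1)
  have h2 : (zc n (k ν) (p ν)).re ^ 2 + 25 / 16 * (zc n (k ν) (p ν)).im ^ 2 ≤ 2 * ‖zc n (k ν) (p ν)‖ ^ 2 := by
    rw [Complex.sq_norm, Complex.normSq_apply]; nlinarith [sq_nonneg (zc n (k ν) (p ν)).re, sq_nonneg (zc n (k ν) (p ν)).im]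
  have h3 : ‖zc n (k ν) (p ν)‖ ^ 2 ≤ (11 * omega n (k ν : ℕ)) ^ 2 := pow_le_pow_left₀ (norm_nonneg _) hz 2
  nlinarith

/-- [folklore] `‖W1(K⋆) − 1‖ ≤ 4^d·91·Ω∕n²` on the fat region (`norm_prod_sub_one_le` with `‖swc‖ ≤ 4`, `‖swc−1‖ ≤ 3‖zc‖²∕4n²`,
`3·121∕4 ≤ 91`). -/
theorem norm_W1_mstar_sub_one_le (n L : ℕ) [NeZero n] [NeZero L] {r : ℝ} (hr : r ≤ 1 / 4) {p : Fin d → ℂ}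
    (hp : p ∈ Fat d r) (k : Fin d → Fin n) :
    ‖W1 n L (Kof n L k (Mstar n L k)) p - 1‖ ≤ 4 ^ d * 91 * Om n k / (n : ℝ) ^ 2 := by
  have hn : 1 ≤ n := Nat.pos_of_ne_zero (NeZero.ne n)
  have hL : 1 ≤ L := Nat.pos_of_ne_zero (NeZero.ne L)
  have hn0 : (0 : ℝ) < n := by exact_mod_cast hn
  rw [W1_mstar_eq]
  have key := norm_prod_sub_one_le (Finset.univ : Finset (Fin d)) (fun ν => swc n L (zc n (k ν) (p ν)))
    (B := 4) (by norm_num) (fun ν => 91 * omega n (k ν : ℕ) ^ 2 / (n : ℝ) ^ 2)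
    (fun ν _ => by positivity)
    (fun ν _ => norm_swc_le n L hn hL _ (by rw [zc_im]; exact (fat_coord hr hp ν).2.2))
    (fun ν _ => by
      obtain ⟨hre, him, him1⟩ := fat_coord hr hp ν
      have hz := norm_zc_le n (k ν) (p ν) hre him
      have h1 := norm_swc_sub_one_le n L hn hL (zc n (k ν) (p ν)) (by rw [zc_im]; exact him1)
      have h3 : ‖zc n (k ν) (p ν)‖ ^ 2 ≤ (11 * omega n (k ν : ℕ)) ^ 2 := pow_le_pow_left₀ (norm_nonneg _) hz 2
      calc ‖swc n L (zc n (k ν) (p ν)) - 1‖ ≤ 3 * ‖zc n (k ν) (p ν)‖ ^ 2 / (4 * (n : ℝ) ^ 2) := h1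
        _ ≤ 3 * (11 * omega n (k ν : ℕ)) ^ 2 / (4 * (n : ℝ) ^ 2) := by gcongr
        _ ≤ 91 * omega n (k ν : ℕ) ^ 2 / (n : ℝ) ^ 2 := by
            rw [div_le_div_iff₀ (by positivity) (by positivity)]
            nlinarith [sq_nonneg (omega n (k ν : ℕ)), sq_nonneg (n : ℝ)])
  rw [Finset.card_univ, Fintype.card_fin] at key
  refine key.trans (le_of_eq ?_)
  unfold Om
  rw [Finset.mul_sum, Finset.mul_sum, Finset.sum_div]
  exact Finset.sum_congr rfl fun ν _ => by ring

/-- [folklore] the constant of the principal sub-alias comparison (`(64∕7)²·[(4^d·91·242 + 29282)(d+1)² + 4^d·91·(d+1)·m²]`). -/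
def CP (d : ℕ) (m2 : ℝ) : ℝ :=
  (64 / 7) ^ 2 * ((4 ^ d * 91 * 242 + 29282) * ((d : ℝ) + 1) ^ 2 + 4 ^ d * 91 * ((d : ℝ) + 1) * m2)

/-- [folklore] `CP ≥ 0` for `m² ≥ 0`. -/
theorem CP_nonneg (d : ℕ) {m2 : ℝ} (hm : 0 ≤ m2) : 0 ≤ CP d m2 := by unfold CP; positivity

/-- [folklore] **THE CONSTANT OF THE CORE ESTIMATE**: `CT d L m² = CP d m² + L^d·4^d·256∕7` (principal + the `L^d − 1` far sub-aliases). -/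
def CT (d L : ℕ) (m2 : ℝ) : ℝ := CP d m2 + (L : ℝ) ^ d * 4 ^ d * (256 / 7)

/-- [folklore] `CT ≥ 0` for `m² ≥ 0`. -/
theorem CT_nonneg (d L : ℕ) {m2 : ℝ} (hm : 0 ≤ m2) : 0 ≤ CT d L m2 := by
  have := CP_nonneg d hm; unfold CT; positivity

/-- [folklore] the lower bound of every finer-alias denominator above a non-zero coarse alias: `(7∕64)·W_{nL}(Kof k m) ≤ ‖(Δ^{ξ∕L}+m²)(p+2π·Kof k m)‖`
(tree `re_DeltaXi_shift_ge_W` at level `n·L`). -/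
theorem norm_A'_ge (n L : ℕ) [NeZero n] [NeZero L] (m2 : ℝ) (hm : 0 ≤ m2) {r : ℝ} (hr : r ≤ 1 / 4)
    (hdr : (d : ℝ) * r ^ 2 ≤ 1 / 16) {p : Fin d → ℂ} (hp : p ∈ Fat d r) {k : Fin d → Fin n} (hk : k ≠ fun _ => 0)
    (m : Fin d → Fin L) : 7 / 64 * W (n * L) (Kof n L k m) ≤ ‖DeltaXi (n * L) m2 (shift (n * L) (Kof n L k m) p)‖ :=
  (re_DeltaXi_shift_ge_W (n * L) m2 hm hr hdr hp (Kof n L k m) (Kof_ne_zero n L hk m)).trans (Complex.re_le_norm _)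

/-- [folklore] `‖T_k‖ ≤ L^d·4^d·64∕7` for `k ≠ 0` on the fat region (each of the `L^d` terms is `≤ 4^d ∕ (7∕64)`). -/
theorem norm_T_le (n L : ℕ) [NeZero n] [NeZero L] (m2 : ℝ) (hm : 0 ≤ m2) {r : ℝ} (hr : r ≤ 1 / 4)
    (hdr : (d : ℝ) * r ^ 2 ≤ 1 / 16) {p : Fin d → ℂ} (hp : p ∈ Fat d r) {k : Fin d → Fin n} (hk : k ≠ fun _ => 0) :
    ‖T n L m2 k p‖ ≤ (L : ℝ) ^ d * 4 ^ d * (64 / 7) := by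
  have hn : 1 ≤ n := Nat.pos_of_ne_zero (NeZero.ne n)
  have hL : 1 ≤ L := Nat.pos_of_ne_zero (NeZero.ne L)
  unfold T
  refine (norm_sum_le _ _).trans ?_
  have hterm : ∀ m ∈ (Finset.univ : Finset (Fin d → Fin L)),
      ‖W1 n L (Kof n L k m) p / DeltaXi (n * L) m2 (shift (n * L) (Kof n L k m) p)‖ ≤ 4 ^ d * (64 / 7) := by
    intro m _
    have hA := norm_A'_ge n L m2 hm hr hdr hp hk m
    have hW := one_le_W (n * L) (Kof n L k m) (Kof_ne_zero n L hk m)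
    have hA1 : 7 / 64 ≤ ‖DeltaXi (n * L) m2 (shift (n * L) (Kof n L k m) p)‖ := by nlinarith
    have hW1 := norm_W1_le n L hn hL (Kof n L k m) (p := p) (fun ν => (fat_coord hr hp ν).2.2)
    rw [norm_div, div_le_iff₀ (by linarith)]
    calc ‖W1 n L (Kof n L k m) p‖ ≤ 4 ^ d := hW1
      _ = 4 ^ d * (64 / 7) * (7 / 64) := by ring
      _ ≤ 4 ^ d * (64 / 7) * ‖DeltaXi (n * L) m2 (shift (n * L) (Kof n L k m) p)‖ := by gcongr
  refine (Finset.sum_le_sum hterm).trans ?_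
  rw [Finset.sum_const, nsmul_eq_mul, Finset.card_univ, Fintype.card_pi, Finset.prod_const, Fintype.card_fin,
    Finset.card_univ, Fintype.card_fin]
  push_cast
  ring_nf
  rfl

/-- [folklore] the FAR sub-aliases: `‖Σ_{m ≠ M⋆} W1(Kof k m)∕(Δ^{ξ∕L}+m²)(p+2π·Kof k m)‖ ≤ L^d·4^d·(256∕7)∕n²` (`W_{nL} ≥ n²∕4` there). -/
theorem norm_far_sum_le (n L : ℕ) [NeZero n] [NeZero L] (m2 : ℝ) (hm : 0 ≤ m2) {r : ℝ} (hr : r ≤ 1 / 4)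
    (hdr : (d : ℝ) * r ^ 2 ≤ 1 / 16) {p : Fin d → ℂ} (hp : p ∈ Fat d r) {k : Fin d → Fin n} (hk : k ≠ fun _ => 0) :
    ‖∑ m ∈ Finset.univ.erase (Mstar n L k), W1 n L (Kof n L k m) p / DeltaXi (n * L) m2 (shift (n * L) (Kof n L k m) p)‖
      ≤ (L : ℝ) ^ d * 4 ^ d * (256 / 7) / (n : ℝ) ^ 2 := by
  have hn : 1 ≤ n := Nat.pos_of_ne_zero (NeZero.ne n)
  have hL : 1 ≤ L := Nat.pos_of_ne_zero (NeZero.ne L)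
  have hn0 : (0 : ℝ) < n := by exact_mod_cast hn
  refine (norm_sum_le _ _).trans ?_
  have hterm : ∀ m ∈ Finset.univ.erase (Mstar n L k),
      ‖W1 n L (Kof n L k m) p / DeltaXi (n * L) m2 (shift (n * L) (Kof n L k m) p)‖ ≤ 4 ^ d * (256 / 7) / (n : ℝ) ^ 2 := by
    intro m hm'
    have hne : m ≠ Mstar n L k := Finset.ne_of_mem_erase hm'
    have hA := norm_A'_ge n L m2 hm hr hdr hp hk m
    have hWfar := W_Kof_far n L k m hne
    have hA1 : 7 / 64 * ((n : ℝ) ^ 2 / 4) ≤ ‖DeltaXi (n * L) m2 (shift (n * L) (Kof n L k m) p)‖ := by nlinarith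
    have hApos : 0 < ‖DeltaXi (n * L) m2 (shift (n * L) (Kof n L k m) p)‖ := lt_of_lt_of_le (by positivity) hA1
    have hW1 := norm_W1_le n L hn hL (Kof n L k m) (p := p) (fun ν => (fat_coord hr hp ν).2.2)
    rw [norm_div, div_le_iff₀ hApos]
    calc ‖W1 n L (Kof n L k m) p‖ ≤ 4 ^ d := hW1
      _ = 4 ^ d * (256 / 7) / (n : ℝ) ^ 2 * (7 / 64 * ((n : ℝ) ^ 2 / 4)) := by field_simp; ring
      _ ≤ 4 ^ d * (256 / 7) / (n : ℝ) ^ 2 * ‖DeltaXi (n * L) m2 (shift (n * L) (Kof n L k m) p)‖ := by gcongr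
  refine (Finset.sum_le_sum hterm).trans ?_
  rw [Finset.sum_const, nsmul_eq_mul]
  have hcard : ((Finset.univ.erase (Mstar n L k)).card : ℝ) ≤ (L : ℝ) ^ d := by
    have h1 := Finset.card_erase_le (s := (Finset.univ : Finset (Fin d → Fin L))) (a := Mstar n L k)
    have h2 : (Finset.univ : Finset (Fin d → Fin L)).card = L ^ d := by
      rw [Finset.card_univ, Fintype.card_pi, Finset.prod_const, Fintype.card_fin, Finset.card_univ, Fintype.card_fin]
    have : ((Finset.univ.erase (Mstar n L k)).card : ℝ) ≤ ((L ^ d : ℕ) : ℝ) := by exact_mod_cast h2 ▸ h1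
    simpa using this
  have h0 : (0 : ℝ) ≤ 4 ^ d * (256 / 7) / (n : ℝ) ^ 2 := by positivity
  calc ((Finset.univ.erase (Mstar n L k)).card : ℝ) * (4 ^ d * (256 / 7) / (n : ℝ) ^ 2)
      ≤ (L : ℝ) ^ d * (4 ^ d * (256 / 7) / (n : ℝ) ^ 2) := mul_le_mul_of_nonneg_right hcard h0
    _ = (L : ℝ) ^ d * 4 ^ d * (256 / 7) / (n : ℝ) ^ 2 := by ring

/-- [folklore] the PRINCIPAL sub-alias: `‖W1(K⋆)∕(Δ^{ξ∕L}+m²)(p+2πK⋆) − 1∕(Δ^ξ+m²)(p+2πk)‖ ≤ CP(d,m²)∕n²` for `k ≠ 0` on the fat region. -/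
theorem norm_principal_sub_inv_le (n L : ℕ) [NeZero n] [NeZero L] (m2 : ℝ) (hm : 0 ≤ m2) {r : ℝ} (hr : r ≤ 1 / 4)
    (hdr : (d : ℝ) * r ^ 2 ≤ 1 / 16) {p : Fin d → ℂ} (hp : p ∈ Fat d r) {k : Fin d → Fin n} (hk : k ≠ fun _ => 0) :
    ‖W1 n L (Kof n L k (Mstar n L k)) p / DeltaXi (n * L) m2 (shift (n * L) (Kof n L k (Mstar n L k)) p)
        - (DeltaXi n m2 (shift n k p))⁻¹‖ ≤ CP d m2 / (n : ℝ) ^ 2 := by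
  have hn : 1 ≤ n := Nat.pos_of_ne_zero (NeZero.ne n)
  have hn0 : (0 : ℝ) < n := by exact_mod_cast hn
  set A := DeltaXi n m2 (shift n k p) with hAdef
  set A' := DeltaXi (n * L) m2 (shift (n * L) (Kof n L k (Mstar n L k)) p) with hA'def
  set V := W1 n L (Kof n L k (Mstar n L k)) p with hVdef
  have hW : 1 ≤ W n k := one_le_W n k hk
  have hA : 7 / 64 * W n k ≤ ‖A‖ := (re_DeltaXi_shift_ge_W n m2 hm hr hdr hp k hk).trans (Complex.re_le_norm _)
  have hA' : 7 / 64 * W n k ≤ ‖A'‖ := by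
    have h := norm_A'_ge n L m2 hm hr hdr hp hk (Mstar n L k)
    rwa [W_Kof_mstar] at h
  have hApos : 0 < ‖A‖ := lt_of_lt_of_le (by positivity) hA
  have hA'pos : 0 < ‖A'‖ := lt_of_lt_of_le (by positivity) hA'
  have hA0 : A ≠ 0 := norm_pos_iff.mp hApos
  have hA'0 : A' ≠ 0 := norm_pos_iff.mp hA'pos
  have e : V / A' - A⁻¹ = ((V - 1) * A + (A - A')) / (A' * A) := by field_simp; ring
  rw [e, norm_div, norm_mul, div_le_iff₀ (by positivity)]
  -- the four scalar inputs
  have h1 : ‖A - A'‖ ≤ 29282 * Om n k ^ 2 / (n : ℝ) ^ 2 := norm_A_sub_A'_le n L m2 hr hp k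
  have h2 : ‖A‖ ≤ 242 * Om n k + m2 := norm_A_le n m2 hm hr hp k
  have h3 : ‖V - 1‖ ≤ 4 ^ d * 91 * Om n k / (n : ℝ) ^ 2 := norm_W1_mstar_sub_one_le n L hr hp k
  have hΩ : Om n k ≤ ((d : ℝ) + 1) * W n k := Om_le' n k hk
  have hΩ0 : 0 ≤ Om n k := Finset.sum_nonneg fun ν _ => sq_nonneg _
  have hN : ‖(V - 1) * A + (A - A')‖ ≤ 4 ^ d * 91 * Om n k / (n : ℝ) ^ 2 * (242 * Om n k + m2) + 29282 * Om n k ^ 2 / (n : ℝ) ^ 2 :=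
    calc ‖(V - 1) * A + (A - A')‖ ≤ ‖(V - 1) * A‖ + ‖A - A'‖ := norm_add_le _ _
      _ = ‖V - 1‖ * ‖A‖ + ‖A - A'‖ := by rw [norm_mul]
      _ ≤ 4 ^ d * 91 * Om n k / (n : ℝ) ^ 2 * (242 * Om n k + m2) + 29282 * Om n k ^ 2 / (n : ℝ) ^ 2 :=
          add_le_add (mul_le_mul h3 h2 (norm_nonneg _) (by positivity)) h1
  -- bookkeeping: Ω ≤ (d+1)W, W ≥ 1
  have hd0 : (0 : ℝ) ≤ d := Nat.cast_nonneg d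
  have h4d : (0 : ℝ) ≤ 4 ^ d := by positivity
  set Ω := Om n k
  set Wk := W n k
  have hΩ2 : Ω ^ 2 ≤ ((d : ℝ) + 1) ^ 2 * Wk ^ 2 := by
    rw [← mul_pow]; exact pow_le_pow_left₀ hΩ0 hΩ 2
  have hΩm : Ω * m2 ≤ ((d : ℝ) + 1) * Wk ^ 2 * m2 := by
    have : Ω ≤ ((d : ℝ) + 1) * Wk ^ 2 := hΩ.trans (by nlinarith)
    exact mul_le_mul_of_nonneg_right this hm
  have hbig : 4 ^ d * 91 * Ω / (n : ℝ) ^ 2 * (242 * Ω + m2) + 29282 * Ω ^ 2 / (n : ℝ) ^ 2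
      ≤ ((4 ^ d * 91 * 242 + 29282) * ((d : ℝ) + 1) ^ 2 + 4 ^ d * 91 * ((d : ℝ) + 1) * m2) * Wk ^ 2 / (n : ℝ) ^ 2 := by
    have hn2 : (0 : ℝ) < (n : ℝ) ^ 2 := by positivity
    rw [show 4 ^ d * 91 * Ω / (n : ℝ) ^ 2 * (242 * Ω + m2) + 29282 * Ω ^ 2 / (n : ℝ) ^ 2
        = (4 ^ d * 91 * Ω * (242 * Ω + m2) + 29282 * Ω ^ 2) / (n : ℝ) ^ 2 by field_simp]
    rw [div_le_div_iff_of_pos_right hn2]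
    nlinarith [mul_le_mul_of_nonneg_left hΩ2 h4d, mul_le_mul_of_nonneg_left hΩm h4d]
  calc ‖(V - 1) * A + (A - A')‖ ≤ ((4 ^ d * 91 * 242 + 29282) * ((d : ℝ) + 1) ^ 2 + 4 ^ d * 91 * ((d : ℝ) + 1) * m2) * Wk ^ 2 / (n : ℝ) ^ 2 :=
        hN.trans hbig
    _ = CP d m2 / (n : ℝ) ^ 2 * ((7 / 64 * Wk) * (7 / 64 * Wk)) := by unfold CP; field_simp
    _ ≤ CP d m2 / (n : ℝ) ^ 2 * (‖A'‖ * ‖A‖) := by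
        have hCP : 0 ≤ CP d m2 / (n : ℝ) ^ 2 := div_nonneg (CP_nonneg d hm) (by positivity)
        refine mul_le_mul_of_nonneg_left ?_ hCP
        exact mul_le_mul hA' hA (by positivity) (norm_nonneg _)

/-- [folklore] **THE CORE ALIAS ESTIMATE (R2's irrelevance bound, alias-summed, on the complex fat region).**  For every
non-zero coarse alias `k ∈ (Fin n)^d` and every `p ∈ Fat d r` (`r ≤ 1∕4`, `d r² ≤ 1∕16`):
`‖T_k(p) − 1∕(Δ^ξ+m²)(p+2πk)‖ ≤ CT(d,L,m²)∕n²` — the once-sub-averaged finer free propagator and the coarser free propagator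
agree to SECOND order in `ξ = 1∕n` at every alias, uniformly, with no alias weight and no realness needed. -/
theorem norm_T_sub_inv_le (n L : ℕ) [NeZero n] [NeZero L] (m2 : ℝ) (hm : 0 ≤ m2) {r : ℝ} (hr : r ≤ 1 / 4)
    (hdr : (d : ℝ) * r ^ 2 ≤ 1 / 16) {p : Fin d → ℂ} (hp : p ∈ Fat d r) {k : Fin d → Fin n} (hk : k ≠ fun _ => 0) :
    ‖T n L m2 k p - (DeltaXi n m2 (shift n k p))⁻¹‖ ≤ CT d L m2 / (n : ℝ) ^ 2 := by
  have hsplit : T n L m2 k p = W1 n L (Kof n L k (Mstar n L k)) p / DeltaXi (n * L) m2 (shift (n * L) (Kof n L k (Mstar n L k)) p)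
      + ∑ m ∈ Finset.univ.erase (Mstar n L k), W1 n L (Kof n L k m) p / DeltaXi (n * L) m2 (shift (n * L) (Kof n L k m) p) := by
    unfold T; rw [← Finset.add_sum_erase _ _ (Finset.mem_univ (Mstar n L k))]
  rw [hsplit, add_sub_right_comm]
  refine (norm_add_le _ _).trans ?_
  have h1 := norm_principal_sub_inv_le n L m2 hm hr hdr hp hk
  have h2 := norm_far_sum_le n L m2 hm hr hdr hp hk
  unfold CT
  rw [add_div]
  exact add_le_add h1 h2

end Summit.QuantumFields.BalabanUV.Beta.GAN24.SubAveragingCoreEstimate
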